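import Literature.Computability.AlgebraicComplexity.AlmanLi2026CWPowerSpeedup
import Literature.Computability.AlgebraicComplexity.AlmanLi2026BelowBorderRank
import HarnessLib

/-!
# `R̃(cw_q) ≤ γ_{q,n}` (Alman–Li 2026, Cor. 7.1) — discharge of `AlmanLi2026_asymptoticRank_cw_le_gamma`

Topic `Literature/Computability/AlgebraicComplexity` (family `MatrixMultiplication`). Source: J. Alman,
B. Li, *Asymptotic Rank Speedup Theorems, Revisited*, arXiv:2605.21738 (2026), §7.1, Corollary 7.1
(held text `paper:arxiv-2605.21738`, p0017 L83–97): "Combining the above degeneration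
[Prop. 7.1] with (prop:comp_ex) [Prop. 4.5] immediately yields the following asymptotic-rank bound.
**Corollary 7.1.** For any `q ≥ 2` and `n ≥ 1`, define
`γ_{q,n} := ((q+2)^n + q^{2n/3} − ((q+2)^n − 2(q+1)^n + q^n)^{2/3})^{1/n}` and `γ_q := min_n γ_{q,n}`.
Then the small CW tensor satisfies `R̃(cw_q) ≤ γ_q < q + 2`."

This file PROVES the tree's named fact `AlmanLi2026_asymptoticRank_cw_le_gamma`
(`AlmanLi2026SmallCW.lean`): `AlmanLi2026_asymptoticRank_cw_le_gamma_holds`.  Route, as printed: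
Prop. 7.1 (`AlmanLi2026.prop71`, `AlmanLi2026CWPowerSpeedup.lean`) in its three directions —
`cw_q^{⊠n}` and `⟨r⟩` are invariant under the cyclic rotation of the modes, and the one-slice tensors
in the three placements are the tree's `⟨t,1,1⟩, ⟨1,t,1⟩, ⟨1,1,t⟩` up to relabelling — then Prop. 4.5
Case `t > s` (`AlmanLi2026.prop45_of_lt`) for `R̃(cw_q^{⊠n})`, the trivial bound
`R̃ ≤ bR ≤ (q+2)^n` when `t ≤ s` (there `γ_{q,n}^n ≥ (q+2)^n`), `R̃(cw_q)^n ≤ R̃(cw_q^{⊠n})`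
(`asymptoticRank_pow_le_asymptoticRank_kroneckerPow`) and the `n`-th root; the real number
`(q+2)^n − 2(q+1)^n + q^n` is the natural number `t` because `2(q+1)^n ≤ (q+2)^n + q^n` (convexity).
No new definitions, no named facts; net debt −1.

## References

* J. Alman, B. Li, *Asymptotic Rank Speedup Theorems, Revisited*, arXiv:2605.21738 (2026), Prop. 4.5,
  Prop. 7.1, Cor. 7.1 (held text p0010 L80, p0017 L63, p0017 L85). [AlmanLi2026]
* M. Bläser, *Fast Matrix Multiplication*, ToC Graduate Surveys 5 (2013), Lemma 5.5 (rotating the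
  modes of `⟨k,m,n⟩`). [Blaser2013]
-/

noncomputable section

open scoped BigOperators

namespace Literature.Computability.AlgebraicComplexity

namespace AlmanLi2026

universe u

section Plumbing

variable {K : Type u} [CommSemiring K] {ι κ μ ι' κ' μ' : Type*}

/-- `rotate (s ⊕ t) = rotate s ⊕ rotate t`. [folklore] -/
private theorem rotate_directSum (s : ι → κ → μ → K) (t : ι' → κ' → μ' → K) :
    rotate (directSumTensor s t) = directSumTensor (rotate s) (rotate t) := by
  funext b c a
  rcases a with a | a <;> rcases b with b | b <;> rcases c with c | c <;> rfl

/-- `rotate ⟨n⟩ = ⟨n⟩`. [folklore] -/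
private theorem rotate_unit (n : ℕ) : rotate (unitTensor K n) = unitTensor K n := by
  funext b c a
  simp only [rotate_apply, unitTensor_apply]
  exact if_congr ⟨fun ⟨h1, h2⟩ => ⟨h2, (h1.trans h2).symm⟩, fun ⟨h1, h2⟩ => ⟨(h1.trans h2).symm, h1⟩⟩
    rfl rfl

/-- `rotate (t^{⊠N}) = (rotate t)^{⊠N}`. [folklore] -/
private theorem rotate_kroneckerPow (t : ι → κ → μ → K) (N : ℕ) :
    rotate (kroneckerPow t N) = kroneckerPow (rotate t) N := by
  funext b c a
  simp [rotate_apply, kroneckerPow_apply]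

/-- The little Coppersmith–Winograd tensor is invariant under the cyclic rotation of its modes
(its support condition is cyclically symmetric). [cite: ConnerGesmundoLandsbergVentura2022, eq. (1)] -/
theorem rotate_cwTensor (q : ℕ) : rotate (cwTensor K q) = cwTensor K q := by
  funext b c a
  simp only [rotate_apply, cwTensor_apply]
  refine if_congr ⟨?_, ?_⟩ rfl rfl
  · rintro (h | ⟨h1, h2, h3⟩ | ⟨h1, h2, h3⟩)
    · exact Or.inr (Or.inr h)
    · exact Or.inl ⟨h1, h2.symm, fun hc => h3 (h2.trans hc)⟩
    · exact Or.inr (Or.inl ⟨h1, h2.symm, fun hb => h3 (h2.trans hb)⟩)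
  · rintro (⟨h1, h2, h3⟩ | ⟨h1, h2, h3⟩ | h)
    · exact Or.inr (Or.inl ⟨h1, h2.symm, fun ha => h3 (h2.trans ha)⟩)
    · exact Or.inr (Or.inr ⟨h1, h2.symm, fun ha => h3 (h2.trans ha)⟩)
    · exact Or.inl h

omit [CommSemiring K] in
/-- `rotate³ = id`. [folklore] -/
private theorem rotate_rotate_rotate' (t : ι → κ → μ → K) : rotate (rotate (rotate t)) = t := rfl

end Plumbing

section Directions

variable {K : Type u} [CommSemiring K]

/-- `⟨s,1,1⟩ ≥ rotate oneSlice(s)` (trivial factor third; relabel `x ↦ (x, 0)`). [cite: Blaser2013, Lemma 5.5] -/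
theorem tensorRestrictsTo_matMul_rotate₁ (s : ℕ) :
    TensorRestrictsTo (matMulTensor K s 1 1) (rotate (oneSliceTensor K (Fin s))) := by
  have h : rotate (oneSliceTensor K (Fin s)) = fun (x y : Fin s) (_ : Unit) =>
      matMulTensor K s 1 1 (x, (0 : Fin 1)) (y, (0 : Fin 1)) ((0 : Fin 1), (0 : Fin 1)) := by
    funext x y u
    simp [matMulTensor, rotate_apply, oneSliceTensor_apply]
  rw [h]
  exact tensorRestrictsTo_precomp (matMulTensor K s 1 1) _ _ _

/-- `rotate oneSlice(t) ≥ ⟨t,1,1⟩` (relabel `a ↦ a.1`). [cite: Blaser2013, Lemma 5.5] -/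
theorem tensorRestrictsTo_rotate₁_matMul (t : ℕ) :
    TensorRestrictsTo (rotate (oneSliceTensor K (Fin t))) (matMulTensor K t 1 1) := by
  have h : matMulTensor K t 1 1 = fun (a : Fin t × Fin 1) (b : Fin t × Fin 1) (_ : Fin 1 × Fin 1) =>
      rotate (oneSliceTensor K (Fin t)) a.1 b.1 () := by
    funext a b c
    simp [matMulTensor, rotate_apply, oneSliceTensor_apply, Subsingleton.elim b.2 c.1,
      Subsingleton.elim a.2 c.2]
  rw [h]
  exact tensorRestrictsTo_precomp (rotate (oneSliceTensor K (Fin t))) _ _ _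

/-- `⟨1,1,s⟩ ≥ rotate² oneSlice(s)` (trivial factor second). [cite: Blaser2013, Lemma 5.5] -/
theorem tensorRestrictsTo_matMul_rotate₂ (s : ℕ) :
    TensorRestrictsTo (matMulTensor K 1 1 s) (rotate (rotate (oneSliceTensor K (Fin s)))) := by
  have h : rotate (rotate (oneSliceTensor K (Fin s))) = fun (y : Fin s) (_ : Unit) (x : Fin s) =>
      matMulTensor K 1 1 s ((0 : Fin 1), y) ((0 : Fin 1), (0 : Fin 1)) ((0 : Fin 1), x) := by
    funext y u x
    simp [matMulTensor, rotate_apply, oneSliceTensor_apply, eq_comm]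
  rw [h]
  exact tensorRestrictsTo_precomp (matMulTensor K 1 1 s) _ _ _

/-- `rotate² oneSlice(t) ≥ ⟨1,1,t⟩`. [cite: Blaser2013, Lemma 5.5] -/
theorem tensorRestrictsTo_rotate₂_matMul (t : ℕ) :
    TensorRestrictsTo (rotate (rotate (oneSliceTensor K (Fin t)))) (matMulTensor K 1 1 t) := by
  have h : matMulTensor K 1 1 t = fun (a : Fin 1 × Fin t) (_ : Fin 1 × Fin 1) (c : Fin 1 × Fin t) =>
      rotate (rotate (oneSliceTensor K (Fin t))) a.2 () c.2 := by
    funext a b c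
    simp [matMulTensor, rotate_apply, oneSliceTensor_apply, Subsingleton.elim a.1 b.1,
      Subsingleton.elim b.2 c.1, eq_comm]
  rw [h]
  exact tensorRestrictsTo_precomp (rotate (rotate (oneSliceTensor K (Fin t)))) _ _ _

end Directions

/-! ## Prop. 7.1 in the three directions of Prop. 4.5 -/

section ThreeDirections

variable (K : Type) [Field K] (q n : ℕ)

/-- Prop. 7.1 in the placement `⟨t,1,1⟩`. [cite: AlmanLi2026, Prop. 7.1] -/
theorem prop71_dir₁ :
    AlgDegeneratesTo
      (directSumTensor (unitTensor K ((q + 2) ^ n)) (matMulTensor K (q ^ n) 1 1))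
      (directSumTensor (kroneckerPow (cwTensor K q) n)
        (matMulTensor K ((q + 2) ^ n + q ^ n - 2 * (q + 1) ^ n) 1 1)) := by
  classical
  exact (((TensorRestrictsTo.refl _).directSum (tensorRestrictsTo_matMul_rotate₁ (q ^ n)))
    |>.algDegeneratesTo_trans (prop71 K q n)).trans_restrictsTo
    ((TensorRestrictsTo.refl _).directSum (tensorRestrictsTo_rotate₁_matMul _))

/-- Prop. 7.1 rotated once: placement `⟨1,1,t⟩`. [cite: AlmanLi2026, Prop. 7.1] -/
theorem prop71_dir₃ :
    AlgDegeneratesTo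
      (directSumTensor (unitTensor K ((q + 2) ^ n)) (matMulTensor K 1 1 (q ^ n)))
      (directSumTensor (kroneckerPow (cwTensor K q) n)
        (matMulTensor K 1 1 ((q + 2) ^ n + q ^ n - 2 * (q + 1) ^ n))) := by
  classical
  have h1 := algDegeneratesTo_rotate_modes (prop71 K q n)
  simp only [rotate_directSum, rotate_unit, rotate_kroneckerPow, rotate_cwTensor] at h1
  exact (((TensorRestrictsTo.refl _).directSum (tensorRestrictsTo_matMul_rotate₂ (q ^ n)))
    |>.algDegeneratesTo_trans h1).trans_restrictsTo
    ((TensorRestrictsTo.refl _).directSum (tensorRestrictsTo_rotate₂_matMul _))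

/-- Prop. 7.1 rotated twice: placement `⟨1,t,1⟩`. [cite: AlmanLi2026, Prop. 7.1] -/
theorem prop71_dir₂ :
    AlgDegeneratesTo
      (directSumTensor (unitTensor K ((q + 2) ^ n)) (matMulTensor K 1 (q ^ n) 1))
      (directSumTensor (kroneckerPow (cwTensor K q) n)
        (matMulTensor K 1 ((q + 2) ^ n + q ^ n - 2 * (q + 1) ^ n) 1)) := by
  classical
  have h1 := algDegeneratesTo_rotate_modes (algDegeneratesTo_rotate_modes (prop71 K q n))
  simp only [rotate_directSum, rotate_unit, rotate_kroneckerPow, rotate_cwTensor,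
    rotate_rotate_rotate'] at h1
  exact (((TensorRestrictsTo.refl _).directSum
      (tensorRestrictsTo_matMulTensor_oneSliceTensor (Function.Embedding.refl (Fin (q ^ n)))))
    |>.algDegeneratesTo_trans h1).trans_restrictsTo
    ((TensorRestrictsTo.refl _).directSum
      (tensorRestrictsTo_oneSliceTensor_matMulTensor (Equiv.refl _)))

end ThreeDirections

/-! ## Cor. 7.1 -/

/-- Convexity of `x ↦ x^n` at the integers `q, q+1, q+2`: `2(q+1)^n ≤ (q+2)^n + q^n`
("all bases are nonnegative reals: the inner difference is a second difference of the convex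
`x ↦ x^n`"). [cite: AlmanLi2026, Cor 7.1] -/
theorem two_mul_pow_succ_le (q : ℕ) : ∀ n : ℕ, 2 * (q + 1) ^ n ≤ (q + 2) ^ n + q ^ n
  | 0 => by simp
  | n + 1 => by
      have ih := two_mul_pow_succ_le q n
      have hle : q ^ n ≤ (q + 2) ^ n := Nat.pow_le_pow_left (by omega) n
      rw [pow_succ, pow_succ, pow_succ]
      nlinarith

/-- **Alman–Li 2026, Cor. 7.1, for `R̃(cw_q^{⊠n})`**: for `q ≥ 2` (and any `n`),
`R̃(cw_q^{⊠n}) ≤ (q+2)^n + (q^n)^{2/3} − t^{2/3}` with `t = (q+2)^n + q^n − 2(q+1)^n`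
(Prop. 4.5 Case 1 on the three directions of Prop. 7.1 when `t > q^n`; otherwise the right-hand
side is at least `(q+2)^n ≥ bR ≥ R̃`). [cite: AlmanLi2026, Cor 7.1] -/
theorem asymptoticRank_kroneckerPow_cwTensor_le (K : Type) [Field K] {q : ℕ} (hq : 2 ≤ q) (n : ℕ) :
    asymptoticRank (kroneckerPow (cwTensor K q) n) ≤
      ((q + 2) ^ n : ℕ) + ((((q ^ n : ℕ) : ℝ) ^ (2 / 3 : ℝ)) -
        (((q + 2) ^ n + q ^ n - 2 * (q + 1) ^ n : ℕ) : ℝ) ^ (2 / 3 : ℝ)) := by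
  classical
  set r := (q + 2) ^ n with hr
  set s := q ^ n with hs
  set t := (q + 2) ^ n + q ^ n - 2 * (q + 1) ^ n with ht
  have hs1 : 1 ≤ s := Nat.one_le_pow _ _ (by omega)
  by_cases hst : s < t
  · exact AlmanLi2026.prop45_of_lt (kroneckerPow (cwTensor K q) n) hs1 hst
      (prop71_dir₁ K q n) (prop71_dir₂ K q n) (prop71_dir₃ K q n)
  · -- trivial branch: `R̃ ≤ bR(cw_q^{⊠n}) ≤ (q+2)^n ≤ r + (s^{2/3} − t^{2/3})`
    have h1 : asymptoticRank (kroneckerPow (cwTensor K q) n) ≤ (r : ℝ) := by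
      refine (asymptoticRank_le_algBorderRank _).trans ?_
      exact_mod_cast (algBorderRank_kroneckerPow_le (cwTensor K q) n).trans
        (Nat.pow_le_pow_left (algBorderRank_cwTensor_le K q) n)
    have h2 : ((t : ℕ) : ℝ) ^ (2 / 3 : ℝ) ≤ ((s : ℕ) : ℝ) ^ (2 / 3 : ℝ) :=
      Real.rpow_le_rpow (Nat.cast_nonneg _) (by exact_mod_cast not_lt.1 hst) (by norm_num)
    linarith

/-- **Alman–Li 2026, Corollary 7.1, `n`-th power form, over any field**: for `q ≥ 2` and any `n`,
`R̃(cw_q)^n ≤ (q+2)^n + (q^n)^{2/3} − ((q+2)^n − 2(q+1)^n + q^n)^{2/3}` (real bases;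
`R̃(cw_q)^n ≤ R̃(cw_q^{⊠n})`). [cite: AlmanLi2026, Cor 7.1] -/
theorem asymptoticRank_cwTensor_pow_le (K : Type) [Field K] {q : ℕ} (hq : 2 ≤ q) (n : ℕ) :
    asymptoticRank (cwTensor K q) ^ n ≤
      ((q : ℝ) + 2) ^ n + (((q : ℝ) ^ n) ^ (2 / 3 : ℝ)) -
        (((q : ℝ) + 2) ^ n - 2 * ((q : ℝ) + 1) ^ n + (q : ℝ) ^ n) ^ (2 / 3 : ℝ) := by
  have hpow := asymptoticRank_kroneckerPow_cwTensor_le K hq n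
  -- the natural number `t` is the real second difference (`2(q+1)^n ≤ (q+2)^n + q^n`)
  have hcast : (((q + 2) ^ n + q ^ n - 2 * (q + 1) ^ n : ℕ) : ℝ) =
      ((q : ℝ) + 2) ^ n - 2 * ((q : ℝ) + 1) ^ n + (q : ℝ) ^ n := by
    rw [Nat.cast_sub (two_mul_pow_succ_le q n)]
    push_cast
    ring
  have hr : (((q + 2) ^ n : ℕ) : ℝ) = ((q : ℝ) + 2) ^ n := by push_cast; ring
  have hs : (((q ^ n : ℕ) : ℝ)) = (q : ℝ) ^ n := by push_cast; ring
  rw [hcast, hr, hs] at hpow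
  have hle := (asymptoticRank_pow_le_asymptoticRank_kroneckerPow (cwTensor K q) n).trans hpow
  linarith

/-- **Alman–Li 2026, Corollary 7.1, over any field**: for `q ≥ 2`, `n ≥ 1`,
`R̃(cw_q) ≤ γ_{q,n} = ((q+2)^n + (q^n)^{2/3} − ((q+2)^n − 2(q+1)^n + q^n)^{2/3})^{1/n}`.
[cite: AlmanLi2026, Cor 7.1] -/
theorem asymptoticRank_cwTensor_le_gamma (K : Type) [Field K] {q n : ℕ} (hq : 2 ≤ q) (hn : 1 ≤ n) :
    asymptoticRank (cwTensor K q) ≤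
      (((q : ℝ) + 2) ^ n + (((q : ℝ) ^ n) ^ (2 / 3 : ℝ)) -
        (((q : ℝ) + 2) ^ n - 2 * ((q : ℝ) + 1) ^ n + (q : ℝ) ^ n) ^ (2 / 3 : ℝ)) ^ ((n : ℝ)⁻¹) := by
  have hle := asymptoticRank_cwTensor_pow_le K hq n
  have h0 : 0 ≤ asymptoticRank (cwTensor K q) := asymptoticRank_nonneg _
  have hn0 : (n : ℝ) ≠ 0 := by exact_mod_cast (show n ≠ 0 by omega)
  calc asymptoticRank (cwTensor K q)
      = (asymptoticRank (cwTensor K q) ^ n) ^ ((n : ℝ)⁻¹) := by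
        rw [← Real.rpow_natCast, ← Real.rpow_mul h0, mul_inv_cancel₀ hn0, Real.rpow_one]
    _ ≤ _ := Real.rpow_le_rpow (pow_nonneg h0 n) hle (inv_nonneg.2 (Nat.cast_nonneg n))

/-- **Alman–Li 2026, Corollary 7.1** — discharge of the tree's named fact
`AlmanLi2026_asymptoticRank_cw_le_gamma` (`AlmanLi2026SmallCW.lean`; the case `K = ℂ`).
[cite: AlmanLi2026, Cor 7.1] -/
theorem _root_.Literature.Computability.AlgebraicComplexity.AlmanLi2026_asymptoticRank_cw_le_gamma_holds :
    AlmanLi2026_asymptoticRank_cw_le_gamma :=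
  fun _ _ hq hn => asymptoticRank_cwTensor_le_gamma ℂ hq hn

/-! ## Numerical evaluation of `γ_{q,n}` (Table 1, un-iterated column) -/

/-- **Evaluation scheme for Cor. 7.1** (our packaging of the arithmetic): rational certificates
`(q^n)² ≤ a³` (so `(q^n)^{2/3} ≤ a`), `b³ ≤ t²` with `t = (q+2)^n − 2(q+1)^n + q^n` (so `b ≤ t^{2/3}`)
and `(q+2)^n + a − b < c^n` give `R̃(cw_q) < c`, over any field.
[cite: AlmanLi2026, Cor 7.1 with Table 1 (numerical values of `γ_q`)] -/
theorem asymptoticRank_cwTensor_lt_of_certificate (K : Type) [Field K] {q n : ℕ} (hq : 2 ≤ q)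
    {a b c : ℝ} (ha : 0 ≤ a) (hc : 0 ≤ c)
    (ha3 : ((q : ℝ) ^ n) ^ 2 ≤ a ^ 3)
    (hb3 : b ^ 3 ≤ (((q : ℝ) + 2) ^ n - 2 * ((q : ℝ) + 1) ^ n + (q : ℝ) ^ n) ^ 2)
    (hlt : ((q : ℝ) + 2) ^ n + a - b < c ^ n) :
    asymptoticRank (cwTensor K q) < c := by
  have h := asymptoticRank_cwTensor_pow_le K hq n
  have hs0 : 0 ≤ (q : ℝ) ^ n := by positivity
  have ht0 : 0 ≤ ((q : ℝ) + 2) ^ n - 2 * ((q : ℝ) + 1) ^ n + (q : ℝ) ^ n := by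
    have hc' : ((2 * (q + 1) ^ n : ℕ) : ℝ) ≤ (((q + 2) ^ n + q ^ n : ℕ) : ℝ) := by
      exact_mod_cast two_mul_pow_succ_le q n
    push_cast at hc'
    linarith
  -- compare cubes: `(x^{2/3})³ = x²`
  have hcube : ∀ x : ℝ, 0 ≤ x → (x ^ (2 / 3 : ℝ)) ^ (3 : ℕ) = x ^ 2 := fun x hx => by
    rw [← Real.rpow_natCast, ← Real.rpow_mul hx]
    norm_num
  have h1 : ((q : ℝ) ^ n) ^ (2 / 3 : ℝ) ≤ a := by
    by_contra hc'
    have hlt' := pow_lt_pow_left₀ (not_le.1 hc') ha (by norm_num : (3 : ℕ) ≠ 0)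
    rw [hcube _ hs0] at hlt'
    linarith
  have h2 : b ≤ (((q : ℝ) + 2) ^ n - 2 * ((q : ℝ) + 1) ^ n + (q : ℝ) ^ n) ^ (2 / 3 : ℝ) := by
    by_contra hc'
    have hlt' := pow_lt_pow_left₀ (not_le.1 hc') (Real.rpow_nonneg ht0 _)
      (by norm_num : (3 : ℕ) ≠ 0)
    rw [hcube _ ht0] at hlt'
    linarith
  exact lt_of_pow_lt_pow_left₀ n hc (by linarith)

/-- **`R̃(cw_2) < 3.934` over any field** — the instance `q = 2`, `n = 4` of Cor. 7.1:
`γ_{2,4} = (256 + 16^{2/3} − 110^{2/3})^{1/4} = 3.9334…` (certificates `a = 6.35`, `b = 22.95`; the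
evaluation is ours — Table 1 lists `γ_2` with `n = 4` next to the ITERATED value `γ'_2 = 3.931` of
Thm. 1.3, which is the tree's separate fact `AlmanLi2026_asymptoticRank_cwTwo_lt` and is NOT proved
here).  Sharpens the tree's `AlmanLi2026.asymptoticRank_cwTensor_two_lt` (`< 3.96`, Cor. 6.1 with
`k = 4`, `AlmanLi2026BelowBorderRank.lean`). [cite: AlmanLi2026, Cor 7.1, Table 1] -/
theorem cor71_asymptoticRank_cwTensor_two_lt (K : Type) [Field K] :
    asymptoticRank (cwTensor K 2) < 3.934 :=
  asymptoticRank_cwTensor_lt_of_certificate K (q := 2) (n := 4) le_rfl (a := 6.35) (b := 22.95)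
    (by norm_num) (by norm_num) (by norm_num) (by norm_num) (by norm_num)

/-- **`R̃(cw_3) < 4.971` over any field** — the instance `q = 3`, `n = 4` of Cor. 7.1:
`γ_{3,4} = (625 + 81^{2/3} − 194^{2/3})^{1/4} = 4.9701…` (certificates `a = 18.73`, `b = 33.5`;
evaluation ours, cf. Table 1's `γ_3`; border rank `bR(cw_3) = 5`). [cite: AlmanLi2026, Cor 7.1, Table 1] -/
theorem cor71_asymptoticRank_cwTensor_three_lt (K : Type) [Field K] :
    asymptoticRank (cwTensor K 3) < 4.971 :=
  asymptoticRank_cwTensor_lt_of_certificate K (q := 3) (n := 4) (by norm_num) (a := 18.73)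
    (b := 33.5) (by norm_num) (by norm_num) (by norm_num) (by norm_num) (by norm_num)

end AlmanLi2026

end Literature.Computability.AlgebraicComplexity
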